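import Summits.HodgeConjecture.HodgeConjecture.Theorems.NikulinTwinTransportSquareHodgeOfSqrtTwoOfKugaSatake
import Literature.AlgebraicGeometry.Surfaces.K3LatticeInvariantsHolds
import Literature.AlgebraicGeometry.Surfaces.K3LatticeInvariantsSignatureProofs
import Literature.NumberTheory.Transcendental.DeRhamTheoremMultiplicative

/-!
# Route NikulinTwinTransport · its crux, target and frame GRANTED KUGA–SATAKE, modulo `b₂(K3) = 22` ONLY

`…NikulinTwinTransportHodgeSimilitudeAlgebraicOfKugaSatake` and `…NikulinTwinTransportSquareHodgeOfSqrtTwoOfKugaSatake`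
(this seat) prove the route's crux `HodgeSimilitudeAlgebraic` (13676), target X `TwinSimilitudeAlgebraic` (13674),
Buskin item `HodgeIsometryAlgebraic` (13675), support `RealMultiplicationSqrtTwoAlgebraic` (13679), crux
`SquareHodgeOfSqrtTwo` (13680) and frame `Assembly` (13942) GRANTED `IsKSCorrespondenceAlgebraicBetti` for every
projective K3 surface, modulo the marking fact `Huybrechts_K3_marking_exists`. That fact is by now REDUCED IN THE TREE
to the single numerical fact `K3_finrank_complexBetti_two` (`b₂(S) = 22`, Huybrechts Ch. 1 §3.3):
`Huybrechts_K3_marking_exists_holds_of` fed with the PROVED `K3_even_intersectionForm_holds`, the signature package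
`K3_exists_orientation_signature_hodgeRiemann_ample_of_finrank_complexBetti_two`, and the four analytic `_holds`
theorems. Hence (`huybrechts_K3_marking_exists_of_b22`) every one of the six decls holds GRANTED Kuga–Satake, modulo
`b₂ = 22` only: `hodgeSimilitudeAlgebraic_of_kugaSatake_of_b22`, `twinSimilitudeAlgebraic_of_kugaSatake_of_b22`,
`hodgeIsometryAlgebraic_of_kugaSatake_of_b22`, `realMultiplicationSqrtTwoAlgebraic_of_kugaSatake_of_b22`,
**`squareHodgeOfSqrtTwo_of_kugaSatake_of_b22`**, `assembly_of_kugaSatake_of_b22`.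

CONDITIONAL on the Kuga–Satake Hodge conjecture for K3 surfaces (OPEN in print for a general K3) and on `b₂ = 22`
(unproved in the tree). Nothing here says HC or any crux is proved. THEOREMS ONLY; no sorry, no definition, no new
named fact. Prover seat hodge-nonav-19652-p1 (gen 15), `--supports stmt-HodgeConjecture-13680`.

References: D. Huybrechts, *Lectures on K3 Surfaces* Ch. 1 Prop. 3.5 and its proof (p. 24); M. Varesco, Math. Z. 305
(2023) Thm. 2.1, Thm. 5.3; B. van Geemen (2000) §10.
-/

set_option linter.dupNamespace false

noncomputable section

namespace Summit.HodgeConjecture.HodgeConjecture.Theorems.NikulinTwinTransport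

open CategoryTheory Literature.AlgebraicGeometry Literature.AlgebraicGeometry.Motives
open Literature.AlgebraicGeometry.HodgeTheory Literature.AlgebraicGeometry.Surfaces
open Summit.HodgeConjecture.HodgeConjecture.Theses.NikulinTwinTransport

/-- **The marking fact from `b₂ = 22` alone** (the tree's decomposition `Huybrechts_K3_marking_exists_holds_of` fed
with the PROVED even-ness of the intersection form, the signature package derived from `b₂ = 22`, and the four
analytic `_holds` theorems). [cite: Huybrechts2016K3, Ch. 1 Prop. 3.5 and its proof (p. 24)] -/
theorem huybrechts_K3_marking_exists_of_b22 (hb₂ : K3_finrank_complexBetti_two) : Huybrechts_K3_marking_exists :=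
  Huybrechts_K3_marking_exists_holds_of hb₂ K3_even_intersectionForm_holds
    (K3_exists_orientation_signature_hodgeRiemann_ample_of_finrank_complexBetti_two hb₂)
    (fun E _ _ _ M _ _ => Voisin2002_closedForm_top_zero_not_exact_holds (E := E) (M := M))
    Huybrechts_K3_hodgeTypes_H2_holds hodgePQ_independent_of_hodgeModel_holds
    fun E _ _ _ => Literature.NumberTheory.Transcendental.exists_deRhamIsoFamily_holds E

/-- **Crux `HodgeSimilitudeAlgebraic` (stmt-HodgeConjecture-13676) GRANTED Kuga–Satake, modulo `b₂ = 22` only.**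
[cite: Varesco2023, Thm. 5.3] [cite: Huybrechts2016K3, Ch. 1 Prop. 3.5] -/
theorem hodgeSimilitudeAlgebraic_of_kugaSatake_of_b22 (hb₂ : K3_finrank_complexBetti_two)
    (hKS : ∀ (S : SchemeOver ℂ) (hS : IsK3Surface S), IsKSCorrespondenceAlgebraicBetti hS.isSmoothProjective) :
    HodgeSimilitudeAlgebraic :=
  hodgeSimilitudeAlgebraic_of_kugaSatake (huybrechts_K3_marking_exists_of_b22 hb₂) hKS

/-- **Target X `TwinSimilitudeAlgebraic` (stmt-HodgeConjecture-13674) GRANTED Kuga–Satake, modulo `b₂ = 22` only.**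
[cite: Varesco2023, Thm. 5.3] [cite: Huybrechts2016K3, Ch. 1 Prop. 3.5] -/
theorem twinSimilitudeAlgebraic_of_kugaSatake_of_b22 (hb₂ : K3_finrank_complexBetti_two)
    (hKS : ∀ (S : SchemeOver ℂ) (hS : IsK3Surface S), IsKSCorrespondenceAlgebraicBetti hS.isSmoothProjective) :
    TwinSimilitudeAlgebraic :=
  twinSimilitudeAlgebraic_of_kugaSatake (huybrechts_K3_marking_exists_of_b22 hb₂) hKS

/-- **Buskin's item `HodgeIsometryAlgebraic` (stmt-HodgeConjecture-13675) GRANTED Kuga–Satake (no Buskin), modulo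
`b₂ = 22` only.** [cite: Varesco2023, Thm. 5.3] [cite: Huybrechts2016K3, Ch. 1 Prop. 3.5] -/
theorem hodgeIsometryAlgebraic_of_kugaSatake_of_b22 (hb₂ : K3_finrank_complexBetti_two)
    (hKS : ∀ (S : SchemeOver ℂ) (hS : IsK3Surface S), IsKSCorrespondenceAlgebraicBetti hS.isSmoothProjective) :
    HodgeIsometryAlgebraic :=
  hodgeIsometryAlgebraic_of_kugaSatake (huybrechts_K3_marking_exists_of_b22 hb₂) hKS

/-- **`RealMultiplicationSqrtTwoAlgebraic` (stmt-HodgeConjecture-13679) GRANTED Kuga–Satake, modulo `b₂ = 22` only.**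
[cite: Varesco2023, Thm. 2.1 and Thm. 5.3] [cite: Huybrechts2016K3, Ch. 1 Prop. 3.5] -/
theorem realMultiplicationSqrtTwoAlgebraic_of_kugaSatake_of_b22 (hb₂ : K3_finrank_complexBetti_two)
    (hKS : ∀ (S : SchemeOver ℂ) (hS : IsK3Surface S), IsKSCorrespondenceAlgebraicBetti hS.isSmoothProjective) :
    RealMultiplicationSqrtTwoAlgebraic :=
  realMultiplicationSqrtTwoAlgebraic_of_kugaSatake (huybrechts_K3_marking_exists_of_b22 hb₂) hKS

/-- **THE CRUX `SquareHodgeOfSqrtTwo` (stmt-HodgeConjecture-13680: HC⁴(S × S) for projective K3 surfaces with real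
multiplication by `ℚ(√2)`) GRANTED Kuga–Satake for all projective K3 surfaces, modulo `b₂ = 22` only.**
[cite: Varesco2023, Thm. 2.1 and Thm. 5.3] [cite: Huybrechts2016K3, Ch. 1 Prop. 3.5] -/
theorem squareHodgeOfSqrtTwo_of_kugaSatake_of_b22 (hb₂ : K3_finrank_complexBetti_two)
    (hKS : ∀ (S : SchemeOver ℂ) (hS : IsK3Surface S), IsKSCorrespondenceAlgebraicBetti hS.isSmoothProjective) :
    SquareHodgeOfSqrtTwo :=
  squareHodgeOfSqrtTwo_of_kugaSatake (huybrechts_K3_marking_exists_of_b22 hb₂) hKS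

/-- **The frame `Assembly` (stmt-HodgeConjecture-13942) GRANTED Kuga–Satake, modulo `b₂ = 22` only.**
[cite: Varesco2023, Thm. 5.3] [cite: Huybrechts2016K3, Ch. 1 Prop. 3.5] -/
theorem assembly_of_kugaSatake_of_b22 (hb₂ : K3_finrank_complexBetti_two)
    (hKS : ∀ (S : SchemeOver ℂ) (hS : IsK3Surface S), IsKSCorrespondenceAlgebraicBetti hS.isSmoothProjective) :
    Assembly :=
  assembly_of_kugaSatake (huybrechts_K3_marking_exists_of_b22 hb₂) hKS

end Summit.HodgeConjecture.HodgeConjecture.Theorems.NikulinTwinTransport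

end
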